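import Summits.Ventures.CertifiedManyBodySolver.Upper.IntervalReaderEmbedWordSums

/-!
# Ventures/CertifiedManyBodySolver — Upper/IntervalReaderEmbedClaimNode.lean: the EMBED layout of `l3core-sgf`, III —
# the W5 claim nodes from the embed-layout bytes (part 35 of the Theorem-H1′ package; parts 33/34
# `IntervalReaderEmbedLayout`, `IntervalReaderEmbedWordSums`)

HONEST FRAMING: first certified bounds; not a superconductivity verdict; every number certified (two readers)
or labelled float.  A sourced-Hamiltonian upper is a certified variational ENERGY CEILING for
`H − μN − h(Δ_d + Δ_d†)` on one finite box together with windows of the SAME vector; it is never a sign of order and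
never an order-parameter word (LADDER v1.17 (i)).  This file is a DICTIONARY between two layouts of one reader; it
certifies no number and moves no row.

THE GAP (ref-2c g27 RESULT 2, precision P6).  Parts 31/32 state the W5 claim node for the MERGE layout of ird-3's
`l3core-sgf` (`sgf_read.py`, `JOB_LAYOUT=merge`): the sweep runs over `a·b` sites of local dimension 4, site `x` = the
mode pair `(x↑, x↓)` of the transformed frame.  Every read of record is the EMBED layout (`JOB_LAYOUT=embed`, the
production default, `sgf_model.ModeQuadModel.dilated` + `sgf_adapter.embed_modes`): the certificate's `K = 2ab`
spin-orbital tensors are placed on `2ab` l3core sites of local dimension 4 whose SECOND mode is a never-occupied DUMMY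
(«no term touches them; channels pass Z / I through them, and Z|0⟩ = |0⟩»), so the bytes of record (the last `FINAL`
environments, radii, `Nrm`) are those of a `2ab`-site sweep whose CROSS-site words now include what the merge layout
keeps on site (the intra-site one-body word and `−U·n_{x↑}ñ_{x↓}`).  Parts 33–35 prove that those bytes imply the SAME
five- and seven-conjunct claim nodes, through the tree's frozen-environment embedding of Fock spaces
(`Literature/…/FrozenEnvironmentEmbedding`: `frozenEmbed`, `jwEmbed_mul_frozenEmbed`).

THIS FILE: **`producersSourcedBoxNode_of_embedReader`** and **`producersSourcedBoxTwoFieldNode_of_embedReader`** —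
the hypotheses of parts 31/32 restated for the `2ab`-site embed sweep (monotone `e′ : Fin N ≃ Orb (Fin a ×ₗ Fin b)`,
the dilated automaton tables of part 34, the zero dummy slices `A′ j 2 = A′ j 3 = 0`) ⟹ the five- and seven-conjunct
W5 claim nodes of `Upper.sourcedBoxNode_of_gaugedShibaWitness'` / `Upper.sourcedBoxTwoFieldNode_of_gaugedShibaWitness'`,
VERBATIM the conclusions of parts 31/32.  Chain: word-sum sentence / windows on the chain (part 33 §R) → the dilated
lattice (part 34) → `Γ(dilOrb)` and the frozen-environment isometry `V_∅` (part 33 §D/§Q: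
`⟨ψ̃, X ψ̃⟩ = ⟨V_∅ψ̃, Γ(dilOrb)(X) V_∅ψ̃⟩`) → the producers' frame (`gaugedShiba'_conjTranspose_conj_dWaveSourceOpenBox`,
`gaugedShiba'_conjTranspose_conj_totalNumber`); V1 by `isNParticle_undilate`, V3 by part 29's `re_pos_of_window`.
-/

noncomputable section

-- The dilated orbital type `Orb (Orb Λ)` is a twice-nested `Lex` synonym; its `DecidableEq` / `Fintype` instance
-- terms exceed the default answer size of instance synthesis (they are found, but discarded), hence:
set_option synthInstance.maxSize 1024

open Matrix Finset WithLp
open scoped BigOperators ComplexOrder Matrix.Norms.L2Operator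

namespace Summit.Ventures.CertifiedManyBodySolver.Upper.IntervalReader

open Literature.MathematicalPhysics.QuantumLattice
open Literature.MathematicalPhysics.QuantumLattice.JordanWigner
open Literature.MathematicalPhysics.QuantumLattice.JWEmbed
open Literature.MathematicalPhysics.QuantumLattice.TwoCluster (HasParity)

/-! ## §N  The W5 claim nodes from the EMBED-layout bytes -/

section ClaimNodes

variable {a b N D : ℕ}

/-- **THE W5 CLAIM NODE FROM THE EMBED LAYOUT, PRODUCERS' FRAME** (real sign gauge `g i = ±1`).  Hypotheses: the
chain `Fin N` enumerates the DILATED sites monotonically (`e′ : Fin N ≃ Orb (Fin a ×ₗ Fin b)`, so `N = 2ab`); the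
embedded tensors vanish on occupied dummies (`hA2`, `hA3`); the `H̃`-sweep runs over
`quadAutomaton (dGammaHop (orbPullback e′ (dilMatrix 𝓗^ḡ))) (dilNN U e′) (dilOnSite 𝓗^ḡ U μ e′)`, the `Ñ`-sweep over
`quadAutomaton 0 0 (dilNumberOnSite a b e′)`, the `Nrm`-sweep as always; the by-value tests, `n_lo > 0` and the F-V2
labels exactly as in part 31.  Conclusion: part 31's five-conjunct node, verbatim. -/
theorem producersSourcedBoxNode_of_embedReader (U μ h : ℝ) (eQ nlo nhi : ℚ)
    {g : Orb (Fin a ×ₗ Fin b) → ℂ} (hg : ∀ i, g i = 1 ∨ g i = -1) (e' : Fin N ≃ Orb (Fin a ×ₗ Fin b))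
    (he' : ∀ i j, e' i < e' j ↔ i < j) (A : Fin N → MPSTensor 4 D) (hA2 : ∀ j, A j 2 = 0) (hA3 : ∀ j, A j 3 = 0)
    (l r : Fin D → ℂ) (κ : Fin N → ℝ) (hκ0 : ∀ k, 0 ≤ κ k)
    (hκ : ∀ k (z : EuclideanSpace ℂ (Fin D)), ∑ s, ‖toLp 2 (A k s *ᵥ ofLp z)‖ ^ 2 ≤ κ k * ‖z‖ ^ 2)
    -- the `H̃`-sweep over the dilated automaton (producers' frame)
    (Mo : Fin N → QState N → QState N → ℝ) (hM0 : ∀ k b' c, 0 ≤ Mo k b' c)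
    (hMrow : ∀ k b' c s, ∑ s', ‖quadAutomaton (dGammaHop (orbPullback e' (dilMatrix
      (Matrix.of fun i j => star (g i) * g j * w5Nambu a b μ h i j)))) (dilNN U e')
      (dilOnSite (Matrix.of fun i j => star (g i) * g j * w5Nambu a b μ h i j) U μ e') k b' c s s'‖ ≤ Mo k b' c)
    (hMcol : ∀ k b' c s', ∑ s, ‖quadAutomaton (dGammaHop (orbPullback e' (dilMatrix
      (Matrix.of fun i j => star (g i) * g j * w5Nambu a b μ h i j)))) (dilNN U e')
      (dilOnSite (Matrix.of fun i j => star (g i) * g j * w5Nambu a b μ h i j) U μ e') k b' c s s'‖ ≤ Mo k b' c)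
    (YH : Fin (N + 1) → QState N → Matrix (Fin D) (Fin D) ℂ) (ρH : Fin N → QState N → ℝ)
    (hρH : ∀ (k : Fin N) (c : QState N),
      ‖YH k.succ c - ∑ b', transferOp (A k) (quadAutomaton (dGammaHop (orbPullback e' (dilMatrix
      (Matrix.of fun i j => star (g i) * g j * w5Nambu a b μ h i j)))) (dilNN U e')
      (dilOnSite (Matrix.of fun i j => star (g i) * g j * w5Nambu a b μ h i j) U μ e') k b' c) (YH k.castSucc b')‖ ≤ ρH k c)
    (radH : Fin (N + 1) → QState N → ℝ)
    (hrH0 : ∀ b', ‖YH 0 b' -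
      (Pi.single QState.start (vecMulVec (star l) l) : QState N → Matrix (Fin D) (Fin D) ℂ) b'‖ ≤ radH 0 b')
    (hrH : ∀ (k : Fin N) (c : QState N), ∑ b', Mo k b' c * κ k * radH k.castSucc b' + ρH k c ≤ radH k.succ c)
    -- the `Ñ`-sweep
    (Mn : Fin N → QState N → QState N → ℝ) (hMn0 : ∀ k b' c, 0 ≤ Mn k b' c)
    (hMnrow : ∀ k b' c s, ∑ s', ‖quadAutomaton (fun _ _ _ _ => 0) (fun _ _ _ _ => 0) (dilNumberOnSite a b e') k b' c s s'‖ ≤ Mn k b' c)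
    (hMncol : ∀ k b' c s', ∑ s, ‖quadAutomaton (fun _ _ _ _ => 0) (fun _ _ _ _ => 0) (dilNumberOnSite a b e') k b' c s s'‖ ≤ Mn k b' c)
    (YD : Fin (N + 1) → QState N → Matrix (Fin D) (Fin D) ℂ) (ρD : Fin N → QState N → ℝ)
    (hρD : ∀ (k : Fin N) (c : QState N),
      ‖YD k.succ c - ∑ b', transferOp (A k) (quadAutomaton (fun _ _ _ _ => 0) (fun _ _ _ _ => 0) (dilNumberOnSite a b e') k b' c) (YD k.castSucc b')‖ ≤ ρD k c)
    (radD : Fin (N + 1) → QState N → ℝ)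
    (hrD0 : ∀ b', ‖YD 0 b' -
      (Pi.single QState.start (vecMulVec (star l) l) : QState N → Matrix (Fin D) (Fin D) ℂ) b'‖ ≤ radD 0 b')
    (hrD : ∀ (k : Fin N) (c : QState N), ∑ b', Mn k b' c * κ k * radD k.castSucc b' + ρD k c ≤ radD k.succ c)
    -- the `Nrm`-sweep (shared)
    (YN : Fin (N + 1) → Matrix (Fin D) (Fin D) ℂ) (ρN : Fin N → ℝ)
    (hρN : ∀ k : Fin N, ‖YN k.succ - transferOp (A k) 1 (YN k.castSucc)‖ ≤ ρN k)
    (radN : Fin (N + 1) → ℝ) (hrN0 : ‖YN 0 - vecMulVec (star l) l‖ ≤ radN 0)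
    (hrN : ∀ k : Fin N, 1 * κ k * radN k.castSucc + ρN k ≤ radN k.succ)
    -- the by-value ACCEPT test of the energy row against `E = e·ab`
    (hElo : (star r ⬝ᵥ (YH (Fin.last N) QState.fin *ᵥ r)).re +
        (∑ i, ‖r i‖) * (∑ i, ‖r i‖) * radH (Fin.last N) QState.fin ≤
      ((eQ : ℝ) * ((a : ℝ) * b)) * ((star r ⬝ᵥ (YN (Fin.last N) *ᵥ r)).re - (∑ i, ‖r i‖) * (∑ i, ‖r i‖) * radN (Fin.last N)))
    (hEhi : (star r ⬝ᵥ (YH (Fin.last N) QState.fin *ᵥ r)).re +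
        (∑ i, ‖r i‖) * (∑ i, ‖r i‖) * radH (Fin.last N) QState.fin ≤
      ((eQ : ℝ) * ((a : ℝ) * b)) * ((star r ⬝ᵥ (YN (Fin.last N) *ᵥ r)).re + (∑ i, ‖r i‖) * (∑ i, ‖r i‖) * radN (Fin.last N)))
    -- the four by-value window tests of the density row against `n_lo·ab`, `n_hi·ab`
    (hnlo1 : ((nlo : ℝ) * ((a : ℝ) * b)) * ((star r ⬝ᵥ (YN (Fin.last N) *ᵥ r)).re - (∑ i, ‖r i‖) * (∑ i, ‖r i‖) * radN (Fin.last N)) ≤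
      (star r ⬝ᵥ (YD (Fin.last N) QState.fin *ᵥ r)).re - (∑ i, ‖r i‖) * (∑ i, ‖r i‖) * radD (Fin.last N) QState.fin)
    (hnlo2 : ((nlo : ℝ) * ((a : ℝ) * b)) * ((star r ⬝ᵥ (YN (Fin.last N) *ᵥ r)).re + (∑ i, ‖r i‖) * (∑ i, ‖r i‖) * radN (Fin.last N)) ≤
      (star r ⬝ᵥ (YD (Fin.last N) QState.fin *ᵥ r)).re - (∑ i, ‖r i‖) * (∑ i, ‖r i‖) * radD (Fin.last N) QState.fin)
    (hnhi1 : (star r ⬝ᵥ (YD (Fin.last N) QState.fin *ᵥ r)).re +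
        (∑ i, ‖r i‖) * (∑ i, ‖r i‖) * radD (Fin.last N) QState.fin ≤
      ((nhi : ℝ) * ((a : ℝ) * b)) * ((star r ⬝ᵥ (YN (Fin.last N) *ᵥ r)).re - (∑ i, ‖r i‖) * (∑ i, ‖r i‖) * radN (Fin.last N)))
    (hnhi2 : (star r ⬝ᵥ (YD (Fin.last N) QState.fin *ᵥ r)).re +
        (∑ i, ‖r i‖) * (∑ i, ‖r i‖) * radD (Fin.last N) QState.fin ≤
      ((nhi : ℝ) * ((a : ℝ) * b)) * ((star r ⬝ᵥ (YN (Fin.last N) *ᵥ r)).re + (∑ i, ‖r i‖) * (∑ i, ‖r i‖) * radN (Fin.last N)))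
    -- the code's assertion `n_lo > 0` (h1sweep.py l.398) and the certificate's F-V2 labels (right label `Ñ`)
    (hn : (∑ i, ‖r i‖) * (∑ i, ‖r i‖) * radN (Fin.last N) < (star r ⬝ᵥ (YN (Fin.last N) *ᵥ r)).re)
    (Nt : ℕ) (c : Fin (N + 1) → Fin D → ℕ)
    (hcl : ∀ α, l α ≠ 0 → c 0 α = 0) (hcr : ∀ β, r β ≠ 0 → c (Fin.last N) β = Nt)
    (hcA : ∀ (j : Fin N) (s : Fin 4) (α β : Fin D), A j s α β ≠ 0 → c j.succ β = c j.castSucc α + siteCharge s) :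
    ∃ ψ : Fock (Orb (Fin a ×ₗ Fin b)), HasParity (Nt + a * b) ψ ∧ star ψ ⬝ᵥ ψ = 1 ∧
      (star ψ ⬝ᵥ (dWaveSourceOpenBox a b U μ h *ᵥ ψ)).re ≤ ((eQ : ℚ) : ℝ) * ((a : ℝ) * b) ∧
      ((nlo : ℚ) : ℝ) * ((a : ℝ) * b) ≤ (star ψ ⬝ᵥ (totalNumber *ᵥ ψ)).re ∧
      (star ψ ⬝ᵥ (totalNumber *ᵥ ψ)).re ≤ ((nhi : ℚ) : ℝ) * ((a : ℝ) * b) := by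
  have hg' : ∀ i, ‖g i‖ = 1 := fun i => by rcases hg i with h1 | h1 <;> simp [h1]
  have hsupp := mpsOpenVar_eq_zero_of_dummy A l r hA2 hA3
  -- the energy row on the chain, then un-dilated
  have hEc := wordSum_sentence_of_reader _ _ _ A l r κ hκ0 hκ Mo hM0 hMrow hMcol YH ρH hρH radH hrH0 hrH YN ρN hρN radN
    hrN0 hrN ((eQ : ℝ) * ((a : ℝ) * b)) hElo hEhi
  have hE : (star (undilate e' (mpsOpenVar N A l r)) ⬝ᵥ
      (((partialParticleHole (spinDownOrbitals : Finset (Orb (Fin a ×ₗ Fin b))) * orbitalPhase g)ᴴ *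
          dWaveSourceOpenBox a b U μ h *
          (partialParticleHole (spinDownOrbitals : Finset (Orb (Fin a ×ₗ Fin b))) * orbitalPhase g)) *ᵥ
        undilate e' (mpsOpenVar N A l r))).re ≤
      (eQ : ℝ) * ((a : ℝ) * b) * (star (undilate e' (mpsOpenVar N A l r)) ⬝ᵥ undilate e' (mpsOpenVar N A l r)).re := by
    rw [gaugedShiba'_conjTranspose_conj_dWaveSourceOpenBox (a := a) (b := b) U μ h hg',
      undilate_sandwich e' _ hsupp, jwEmbed_dilOrb_quadratic,
      inner_dilQuadratic_eq_quadWordSum _ (gaugedNambu_symm_of_sign μ h hg) U μ e' he', undilate_norm e' _ hsupp]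
    exact hEc
  -- the density window on the chain, then un-dilated
  have hDc := wordSum_window_of_reader _ _ _ A l r κ hκ0 hκ Mn hMn0 hMnrow hMncol YD ρD hρD radD hrD0 hrD YN ρN hρN radN
    hrN0 hrN ((nlo : ℝ) * ((a : ℝ) * b)) ((nhi : ℝ) * ((a : ℝ) * b)) hnlo1 hnlo2 hnhi1 hnhi2
  have hDW : (nlo : ℝ) * ((a : ℝ) * b) * (star (undilate e' (mpsOpenVar N A l r)) ⬝ᵥ undilate e' (mpsOpenVar N A l r)).re ≤
      (star (undilate e' (mpsOpenVar N A l r)) ⬝ᵥ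
        (((partialParticleHole (spinDownOrbitals : Finset (Orb (Fin a ×ₗ Fin b))) * orbitalPhase g)ᴴ * totalNumber *
            (partialParticleHole (spinDownOrbitals : Finset (Orb (Fin a ×ₗ Fin b))) * orbitalPhase g)) *ᵥ
          undilate e' (mpsOpenVar N A l r))).re ∧
      (star (undilate e' (mpsOpenVar N A l r)) ⬝ᵥ
        (((partialParticleHole (spinDownOrbitals : Finset (Orb (Fin a ×ₗ Fin b))) * orbitalPhase g)ᴴ * totalNumber *
            (partialParticleHole (spinDownOrbitals : Finset (Orb (Fin a ×ₗ Fin b))) * orbitalPhase g)) *ᵥ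
          undilate e' (mpsOpenVar N A l r))).re ≤
      (nhi : ℝ) * ((a : ℝ) * b) * (star (undilate e' (mpsOpenVar N A l r)) ⬝ᵥ undilate e' (mpsOpenVar N A l r)).re := by
    rw [gaugedShiba'_conjTranspose_conj_totalNumber hg', undilate_sandwich e' _ hsupp, jwEmbed_dilOrb_number,
      inner_dilNumber_eq_quadWordSum e', undilate_norm e' _ hsupp]
    exact hDc
  -- V1 and V3, un-dilated
  have hN : IsNParticle Nt (undilate e' (mpsOpenVar N A l r)) := by
    apply isNParticle_undilate
    rw [isNParticle_iff, LinearEquiv.apply_symm_apply]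
    exact mpsOpenVar_relabel_eq_zero_of_charge e' A l r Nt c hcl hcr hcA
  have hpos : 0 < (star (undilate e' (mpsOpenVar N A l r)) ⬝ᵥ undilate e' (mpsOpenVar N A l r)).re := by
    rw [undilate_norm e' _ hsupp, ← star_compEquiv_dotProduct e']
    exact re_pos_of_window (norm_window_of_reader e' A l r κ hκ0 hκ YN ρN hρN radN hrN0 hrN) hn
  exact sourcedBoxNode_of_gaugedShibaWitness' a b U μ h eQ nlo nhi hg' _ hN hpos hE hDW.1 hDW.2

/-- **THE W5 TWO-FIELD (SEVEN-CONJUNCT) CLAIM NODE FROM THE EMBED LAYOUT, PRODUCERS' FRAME.**  Part 32's hypotheses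
restated for the embed sweep: the `H̃`-sweep (field `h`), the `H̃₀`-sweep (field `0`, the SAME witness, window tests
against `e0_lo·ab`, `e0_hi·ab`), the `Ñ`-sweep, the `Nrm`-sweep, the by-value tests, `n_lo > 0`, the F-V2 labels,
and the zero dummy slices.  Conclusion: part 32's seven-conjunct node, verbatim. -/
theorem producersSourcedBoxTwoFieldNode_of_embedReader (U μ h : ℝ) (eQ nlo nhi e0lo e0hi : ℚ)
    {g : Orb (Fin a ×ₗ Fin b) → ℂ} (hg : ∀ i, g i = 1 ∨ g i = -1) (e' : Fin N ≃ Orb (Fin a ×ₗ Fin b))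
    (he' : ∀ i j, e' i < e' j ↔ i < j) (A : Fin N → MPSTensor 4 D) (hA2 : ∀ j, A j 2 = 0) (hA3 : ∀ j, A j 3 = 0)
    (l r : Fin D → ℂ) (κ : Fin N → ℝ) (hκ0 : ∀ k, 0 ≤ κ k)
    (hκ : ∀ k (z : EuclideanSpace ℂ (Fin D)), ∑ s, ‖toLp 2 (A k s *ᵥ ofLp z)‖ ^ 2 ≤ κ k * ‖z‖ ^ 2)
    -- the `H̃`-sweep (field `h`) over the dilated automaton
    (Mo : Fin N → QState N → QState N → ℝ) (hM0 : ∀ k b' c, 0 ≤ Mo k b' c)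
    (hMrow : ∀ k b' c s, ∑ s', ‖quadAutomaton (dGammaHop (orbPullback e' (dilMatrix
      (Matrix.of fun i j => star (g i) * g j * w5Nambu a b μ h i j)))) (dilNN U e')
      (dilOnSite (Matrix.of fun i j => star (g i) * g j * w5Nambu a b μ h i j) U μ e') k b' c s s'‖ ≤ Mo k b' c)
    (hMcol : ∀ k b' c s', ∑ s, ‖quadAutomaton (dGammaHop (orbPullback e' (dilMatrix
      (Matrix.of fun i j => star (g i) * g j * w5Nambu a b μ h i j)))) (dilNN U e')
      (dilOnSite (Matrix.of fun i j => star (g i) * g j * w5Nambu a b μ h i j) U μ e') k b' c s s'‖ ≤ Mo k b' c)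
    (YH : Fin (N + 1) → QState N → Matrix (Fin D) (Fin D) ℂ) (ρH : Fin N → QState N → ℝ)
    (hρH : ∀ (k : Fin N) (c : QState N),
      ‖YH k.succ c - ∑ b', transferOp (A k) (quadAutomaton (dGammaHop (orbPullback e' (dilMatrix
      (Matrix.of fun i j => star (g i) * g j * w5Nambu a b μ h i j)))) (dilNN U e')
      (dilOnSite (Matrix.of fun i j => star (g i) * g j * w5Nambu a b μ h i j) U μ e') k b' c) (YH k.castSucc b')‖ ≤ ρH k c)
    (radH : Fin (N + 1) → QState N → ℝ)
    (hrH0 : ∀ b', ‖YH 0 b' -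
      (Pi.single QState.start (vecMulVec (star l) l) : QState N → Matrix (Fin D) (Fin D) ℂ) b'‖ ≤ radH 0 b')
    (hrH : ∀ (k : Fin N) (c : QState N), ∑ b', Mo k b' c * κ k * radH k.castSucc b' + ρH k c ≤ radH k.succ c)
    -- the `H̃₀`-sweep (field `0`, the SAME witness)
    (Mz : Fin N → QState N → QState N → ℝ) (hMz0 : ∀ k b' c, 0 ≤ Mz k b' c)
    (hMzrow : ∀ k b' c s, ∑ s', ‖quadAutomaton (dGammaHop (orbPullback e' (dilMatrix
      (Matrix.of fun i j => star (g i) * g j * w5Nambu a b μ 0 i j)))) (dilNN U e')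
      (dilOnSite (Matrix.of fun i j => star (g i) * g j * w5Nambu a b μ 0 i j) U μ e') k b' c s s'‖ ≤ Mz k b' c)
    (hMzcol : ∀ k b' c s', ∑ s, ‖quadAutomaton (dGammaHop (orbPullback e' (dilMatrix
      (Matrix.of fun i j => star (g i) * g j * w5Nambu a b μ 0 i j)))) (dilNN U e')
      (dilOnSite (Matrix.of fun i j => star (g i) * g j * w5Nambu a b μ 0 i j) U μ e') k b' c s s'‖ ≤ Mz k b' c)
    (YZ : Fin (N + 1) → QState N → Matrix (Fin D) (Fin D) ℂ) (ρZ : Fin N → QState N → ℝ)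
    (hρZ : ∀ (k : Fin N) (c : QState N),
      ‖YZ k.succ c - ∑ b', transferOp (A k) (quadAutomaton (dGammaHop (orbPullback e' (dilMatrix
      (Matrix.of fun i j => star (g i) * g j * w5Nambu a b μ 0 i j)))) (dilNN U e')
      (dilOnSite (Matrix.of fun i j => star (g i) * g j * w5Nambu a b μ 0 i j) U μ e') k b' c) (YZ k.castSucc b')‖ ≤ ρZ k c)
    (radZ : Fin (N + 1) → QState N → ℝ)
    (hrZ0 : ∀ b', ‖YZ 0 b' -
      (Pi.single QState.start (vecMulVec (star l) l) : QState N → Matrix (Fin D) (Fin D) ℂ) b'‖ ≤ radZ 0 b')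
    (hrZ : ∀ (k : Fin N) (c : QState N), ∑ b', Mz k b' c * κ k * radZ k.castSucc b' + ρZ k c ≤ radZ k.succ c)
    -- the `Ñ`-sweep
    (Mn : Fin N → QState N → QState N → ℝ) (hMn0 : ∀ k b' c, 0 ≤ Mn k b' c)
    (hMnrow : ∀ k b' c s, ∑ s', ‖quadAutomaton (fun _ _ _ _ => 0) (fun _ _ _ _ => 0) (dilNumberOnSite a b e') k b' c s s'‖ ≤ Mn k b' c)
    (hMncol : ∀ k b' c s', ∑ s, ‖quadAutomaton (fun _ _ _ _ => 0) (fun _ _ _ _ => 0) (dilNumberOnSite a b e') k b' c s s'‖ ≤ Mn k b' c)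
    (YD : Fin (N + 1) → QState N → Matrix (Fin D) (Fin D) ℂ) (ρD : Fin N → QState N → ℝ)
    (hρD : ∀ (k : Fin N) (c : QState N),
      ‖YD k.succ c - ∑ b', transferOp (A k) (quadAutomaton (fun _ _ _ _ => 0) (fun _ _ _ _ => 0) (dilNumberOnSite a b e') k b' c) (YD k.castSucc b')‖ ≤ ρD k c)
    (radD : Fin (N + 1) → QState N → ℝ)
    (hrD0 : ∀ b', ‖YD 0 b' -
      (Pi.single QState.start (vecMulVec (star l) l) : QState N → Matrix (Fin D) (Fin D) ℂ) b'‖ ≤ radD 0 b')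
    (hrD : ∀ (k : Fin N) (c : QState N), ∑ b', Mn k b' c * κ k * radD k.castSucc b' + ρD k c ≤ radD k.succ c)
    -- the `Nrm`-sweep (shared)
    (YN : Fin (N + 1) → Matrix (Fin D) (Fin D) ℂ) (ρN : Fin N → ℝ)
    (hρN : ∀ k : Fin N, ‖YN k.succ - transferOp (A k) 1 (YN k.castSucc)‖ ≤ ρN k)
    (radN : Fin (N + 1) → ℝ) (hrN0 : ‖YN 0 - vecMulVec (star l) l‖ ≤ radN 0)
    (hrN : ∀ k : Fin N, 1 * κ k * radN k.castSucc + ρN k ≤ radN k.succ)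
    -- by-value tests: energy row vs `e·ab`
    (hElo : (star r ⬝ᵥ (YH (Fin.last N) QState.fin *ᵥ r)).re +
        (∑ i, ‖r i‖) * (∑ i, ‖r i‖) * radH (Fin.last N) QState.fin ≤
      ((eQ : ℝ) * ((a : ℝ) * b)) * ((star r ⬝ᵥ (YN (Fin.last N) *ᵥ r)).re - (∑ i, ‖r i‖) * (∑ i, ‖r i‖) * radN (Fin.last N)))
    (hEhi : (star r ⬝ᵥ (YH (Fin.last N) QState.fin *ᵥ r)).re +
        (∑ i, ‖r i‖) * (∑ i, ‖r i‖) * radH (Fin.last N) QState.fin ≤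
      ((eQ : ℝ) * ((a : ℝ) * b)) * ((star r ⬝ᵥ (YN (Fin.last N) *ᵥ r)).re + (∑ i, ‖r i‖) * (∑ i, ‖r i‖) * radN (Fin.last N)))
    -- zero-field window vs `e0_lo·ab`, `e0_hi·ab`
    (hz1 : ((e0lo : ℝ) * ((a : ℝ) * b)) * ((star r ⬝ᵥ (YN (Fin.last N) *ᵥ r)).re - (∑ i, ‖r i‖) * (∑ i, ‖r i‖) * radN (Fin.last N)) ≤
      (star r ⬝ᵥ (YZ (Fin.last N) QState.fin *ᵥ r)).re - (∑ i, ‖r i‖) * (∑ i, ‖r i‖) * radZ (Fin.last N) QState.fin)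
    (hz2 : ((e0lo : ℝ) * ((a : ℝ) * b)) * ((star r ⬝ᵥ (YN (Fin.last N) *ᵥ r)).re + (∑ i, ‖r i‖) * (∑ i, ‖r i‖) * radN (Fin.last N)) ≤
      (star r ⬝ᵥ (YZ (Fin.last N) QState.fin *ᵥ r)).re - (∑ i, ‖r i‖) * (∑ i, ‖r i‖) * radZ (Fin.last N) QState.fin)
    (hz3 : (star r ⬝ᵥ (YZ (Fin.last N) QState.fin *ᵥ r)).re +
        (∑ i, ‖r i‖) * (∑ i, ‖r i‖) * radZ (Fin.last N) QState.fin ≤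
      ((e0hi : ℝ) * ((a : ℝ) * b)) * ((star r ⬝ᵥ (YN (Fin.last N) *ᵥ r)).re - (∑ i, ‖r i‖) * (∑ i, ‖r i‖) * radN (Fin.last N)))
    (hz4 : (star r ⬝ᵥ (YZ (Fin.last N) QState.fin *ᵥ r)).re +
        (∑ i, ‖r i‖) * (∑ i, ‖r i‖) * radZ (Fin.last N) QState.fin ≤
      ((e0hi : ℝ) * ((a : ℝ) * b)) * ((star r ⬝ᵥ (YN (Fin.last N) *ᵥ r)).re + (∑ i, ‖r i‖) * (∑ i, ‖r i‖) * radN (Fin.last N)))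
    -- density window vs `n_lo·ab`, `n_hi·ab`
    (hnlo1 : ((nlo : ℝ) * ((a : ℝ) * b)) * ((star r ⬝ᵥ (YN (Fin.last N) *ᵥ r)).re - (∑ i, ‖r i‖) * (∑ i, ‖r i‖) * radN (Fin.last N)) ≤
      (star r ⬝ᵥ (YD (Fin.last N) QState.fin *ᵥ r)).re - (∑ i, ‖r i‖) * (∑ i, ‖r i‖) * radD (Fin.last N) QState.fin)
    (hnlo2 : ((nlo : ℝ) * ((a : ℝ) * b)) * ((star r ⬝ᵥ (YN (Fin.last N) *ᵥ r)).re + (∑ i, ‖r i‖) * (∑ i, ‖r i‖) * radN (Fin.last N)) ≤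
      (star r ⬝ᵥ (YD (Fin.last N) QState.fin *ᵥ r)).re - (∑ i, ‖r i‖) * (∑ i, ‖r i‖) * radD (Fin.last N) QState.fin)
    (hnhi1 : (star r ⬝ᵥ (YD (Fin.last N) QState.fin *ᵥ r)).re +
        (∑ i, ‖r i‖) * (∑ i, ‖r i‖) * radD (Fin.last N) QState.fin ≤
      ((nhi : ℝ) * ((a : ℝ) * b)) * ((star r ⬝ᵥ (YN (Fin.last N) *ᵥ r)).re - (∑ i, ‖r i‖) * (∑ i, ‖r i‖) * radN (Fin.last N)))
    (hnhi2 : (star r ⬝ᵥ (YD (Fin.last N) QState.fin *ᵥ r)).re +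
        (∑ i, ‖r i‖) * (∑ i, ‖r i‖) * radD (Fin.last N) QState.fin ≤
      ((nhi : ℝ) * ((a : ℝ) * b)) * ((star r ⬝ᵥ (YN (Fin.last N) *ᵥ r)).re + (∑ i, ‖r i‖) * (∑ i, ‖r i‖) * radN (Fin.last N)))
    -- the code's assertion `n_lo > 0` (h1sweep.py l.398) and the certificate's F-V2 labels (right label `Ñ`)
    (hn : (∑ i, ‖r i‖) * (∑ i, ‖r i‖) * radN (Fin.last N) < (star r ⬝ᵥ (YN (Fin.last N) *ᵥ r)).re)
    (Nt : ℕ) (c : Fin (N + 1) → Fin D → ℕ)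
    (hcl : ∀ α, l α ≠ 0 → c 0 α = 0) (hcr : ∀ β, r β ≠ 0 → c (Fin.last N) β = Nt)
    (hcA : ∀ (j : Fin N) (s : Fin 4) (α β : Fin D), A j s α β ≠ 0 → c j.succ β = c j.castSucc α + siteCharge s) :
    ∃ ψ : Fock (Orb (Fin a ×ₗ Fin b)), HasParity (Nt + a * b) ψ ∧ star ψ ⬝ᵥ ψ = 1 ∧
      (star ψ ⬝ᵥ (dWaveSourceOpenBox a b U μ h *ᵥ ψ)).re ≤ ((eQ : ℚ) : ℝ) * ((a : ℝ) * b) ∧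
      ((nlo : ℚ) : ℝ) * ((a : ℝ) * b) ≤ (star ψ ⬝ᵥ (totalNumber *ᵥ ψ)).re ∧
      (star ψ ⬝ᵥ (totalNumber *ᵥ ψ)).re ≤ ((nhi : ℚ) : ℝ) * ((a : ℝ) * b) ∧
      ((e0lo : ℚ) : ℝ) * ((a : ℝ) * b) ≤ (star ψ ⬝ᵥ (dWaveSourceOpenBox a b U μ 0 *ᵥ ψ)).re ∧
      (star ψ ⬝ᵥ (dWaveSourceOpenBox a b U μ 0 *ᵥ ψ)).re ≤ ((e0hi : ℚ) : ℝ) * ((a : ℝ) * b) := by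
  have hg' : ∀ i, ‖g i‖ = 1 := fun i => by rcases hg i with h1 | h1 <;> simp [h1]
  have hsupp := mpsOpenVar_eq_zero_of_dummy A l r hA2 hA3
  -- energy row (field `h`)
  have hEc := wordSum_sentence_of_reader _ _ _ A l r κ hκ0 hκ Mo hM0 hMrow hMcol YH ρH hρH radH hrH0 hrH YN ρN hρN radN
    hrN0 hrN ((eQ : ℝ) * ((a : ℝ) * b)) hElo hEhi
  have hE : (star (undilate e' (mpsOpenVar N A l r)) ⬝ᵥ
      (((partialParticleHole (spinDownOrbitals : Finset (Orb (Fin a ×ₗ Fin b))) * orbitalPhase g)ᴴ *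
          dWaveSourceOpenBox a b U μ h *
          (partialParticleHole (spinDownOrbitals : Finset (Orb (Fin a ×ₗ Fin b))) * orbitalPhase g)) *ᵥ
        undilate e' (mpsOpenVar N A l r))).re ≤
      (eQ : ℝ) * ((a : ℝ) * b) * (star (undilate e' (mpsOpenVar N A l r)) ⬝ᵥ undilate e' (mpsOpenVar N A l r)).re := by
    rw [gaugedShiba'_conjTranspose_conj_dWaveSourceOpenBox (a := a) (b := b) U μ h hg',
      undilate_sandwich e' _ hsupp, jwEmbed_dilOrb_quadratic,
      inner_dilQuadratic_eq_quadWordSum _ (gaugedNambu_symm_of_sign μ h hg) U μ e' he', undilate_norm e' _ hsupp]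
    exact hEc
  -- zero-field window (field `0`, same witness)
  have hZc := wordSum_window_of_reader _ _ _ A l r κ hκ0 hκ Mz hMz0 hMzrow hMzcol YZ ρZ hρZ radZ hrZ0 hrZ YN ρN hρN radN
    hrN0 hrN ((e0lo : ℝ) * ((a : ℝ) * b)) ((e0hi : ℝ) * ((a : ℝ) * b)) hz1 hz2 hz3 hz4
  have hZ : (e0lo : ℝ) * ((a : ℝ) * b) * (star (undilate e' (mpsOpenVar N A l r)) ⬝ᵥ undilate e' (mpsOpenVar N A l r)).re ≤
      (star (undilate e' (mpsOpenVar N A l r)) ⬝ᵥ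
        (((partialParticleHole (spinDownOrbitals : Finset (Orb (Fin a ×ₗ Fin b))) * orbitalPhase g)ᴴ *
            dWaveSourceOpenBox a b U μ 0 *
            (partialParticleHole (spinDownOrbitals : Finset (Orb (Fin a ×ₗ Fin b))) * orbitalPhase g)) *ᵥ
          undilate e' (mpsOpenVar N A l r))).re ∧
      (star (undilate e' (mpsOpenVar N A l r)) ⬝ᵥ
        (((partialParticleHole (spinDownOrbitals : Finset (Orb (Fin a ×ₗ Fin b))) * orbitalPhase g)ᴴ *
            dWaveSourceOpenBox a b U μ 0 *
            (partialParticleHole (spinDownOrbitals : Finset (Orb (Fin a ×ₗ Fin b))) * orbitalPhase g)) *ᵥ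
          undilate e' (mpsOpenVar N A l r))).re ≤
      (e0hi : ℝ) * ((a : ℝ) * b) * (star (undilate e' (mpsOpenVar N A l r)) ⬝ᵥ undilate e' (mpsOpenVar N A l r)).re := by
    rw [gaugedShiba'_conjTranspose_conj_dWaveSourceOpenBox (a := a) (b := b) U μ 0 hg',
      undilate_sandwich e' _ hsupp, jwEmbed_dilOrb_quadratic,
      inner_dilQuadratic_eq_quadWordSum _ (gaugedNambu_symm_of_sign μ 0 hg) U μ e' he', undilate_norm e' _ hsupp]
    exact hZc
  -- density window
  have hDc := wordSum_window_of_reader _ _ _ A l r κ hκ0 hκ Mn hMn0 hMnrow hMncol YD ρD hρD radD hrD0 hrD YN ρN hρN radN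
    hrN0 hrN ((nlo : ℝ) * ((a : ℝ) * b)) ((nhi : ℝ) * ((a : ℝ) * b)) hnlo1 hnlo2 hnhi1 hnhi2
  have hDW : (nlo : ℝ) * ((a : ℝ) * b) * (star (undilate e' (mpsOpenVar N A l r)) ⬝ᵥ undilate e' (mpsOpenVar N A l r)).re ≤
      (star (undilate e' (mpsOpenVar N A l r)) ⬝ᵥ
        (((partialParticleHole (spinDownOrbitals : Finset (Orb (Fin a ×ₗ Fin b))) * orbitalPhase g)ᴴ * totalNumber *
            (partialParticleHole (spinDownOrbitals : Finset (Orb (Fin a ×ₗ Fin b))) * orbitalPhase g)) *ᵥ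
          undilate e' (mpsOpenVar N A l r))).re ∧
      (star (undilate e' (mpsOpenVar N A l r)) ⬝ᵥ
        (((partialParticleHole (spinDownOrbitals : Finset (Orb (Fin a ×ₗ Fin b))) * orbitalPhase g)ᴴ * totalNumber *
            (partialParticleHole (spinDownOrbitals : Finset (Orb (Fin a ×ₗ Fin b))) * orbitalPhase g)) *ᵥ
          undilate e' (mpsOpenVar N A l r))).re ≤
      (nhi : ℝ) * ((a : ℝ) * b) * (star (undilate e' (mpsOpenVar N A l r)) ⬝ᵥ undilate e' (mpsOpenVar N A l r)).re := by
    rw [gaugedShiba'_conjTranspose_conj_totalNumber hg', undilate_sandwich e' _ hsupp, jwEmbed_dilOrb_number,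
      inner_dilNumber_eq_quadWordSum e', undilate_norm e' _ hsupp]
    exact hDc
  -- V1 and V3
  have hN : IsNParticle Nt (undilate e' (mpsOpenVar N A l r)) := by
    apply isNParticle_undilate
    rw [isNParticle_iff, LinearEquiv.apply_symm_apply]
    exact mpsOpenVar_relabel_eq_zero_of_charge e' A l r Nt c hcl hcr hcA
  have hpos : 0 < (star (undilate e' (mpsOpenVar N A l r)) ⬝ᵥ undilate e' (mpsOpenVar N A l r)).re := by
    rw [undilate_norm e' _ hsupp, ← star_compEquiv_dotProduct e']
    exact re_pos_of_window (norm_window_of_reader e' A l r κ hκ0 hκ YN ρN hρN radN hrN0 hrN) hn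
  exact sourcedBoxTwoFieldNode_of_gaugedShibaWitness' a b U μ h eQ nlo nhi e0lo e0hi hg' _ hN hpos hE hDW.1 hDW.2
    hZ.1 hZ.2

end ClaimNodes

end Summit.Ventures.CertifiedManyBodySolver.Upper.IntervalReader

end
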